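import Literature.IUT.HodgeArakelov.BadPrimeGaussianMonoidsGenuineRecordOrbitOfInversion
import Literature.IUT.HodgeArakelov.ThetaEvaluationSettingModelAssembly2

/-!
# [IUTchII] Cor 3.5 (ii) at the genuine `θ_env` data: `horbit` / `horb` / `hroots` from the [EtTh] inversion datum and the
# `Δ_Θ`-CLASS-LEVEL [EtTh] Prop 1.4 statements on `η̈^Θ` — (R2)(R3) of files 1–4 pushed down to abc-iut-w4-d010's deepest
# class-level residual (proof-only; row «COR35ii-HORB-GENUINE», file 5)

S. Mochizuki, *Inter-universal Teichmüller theory II*, kurims Dec-2020 manuscript, Prop 2.2 (ii) p. 66, Cor 2.8 (i) p. 82, Prop 3.1 (i)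
p. 87, Cor 3.5 (ii) p. 95 [cite: Mochizuki2012, Prop 2.2 (ii) p.66]; [EtTh] Prop 1.4 (i)–(iii) pp. 20–22 («`Θ̈(Ü) = −Θ̈(Ü⁻¹)`;
`Θ̈(−Ü) = −Θ̈(Ü)`; `Θ̈(q^{a/2}Ü) = (−1)^a q^{−a²/2} Ü^{−2a} Θ̈(Ü)`»), Thm 1.6 (ii) p. 24, Def 2.5 (i) p. 39, Prop 2.2 (i) p. 37, Def 2.7
p. 41 (refereed). Claim key `Mochizuki2012` DISPUTED (D-0012). PROOF-ONLY companion (abc-iut cell, layer L6, seat abc-iut-w4-d004 gen 4;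
node **IUTchII:Cor3.5(ii)**; file 5 of row «COR35ii-HORB-GENUINE»). NO definition, NO `Prop` fact, NO instance; consumed BY NAME:
abc-iut-L2-t8's transports `hsign_of_etaDd_sign` / `hfree_of_etaDd_free` / `not_isOfFinOrder_translate_of_etaDd` /
`hroot_of_coeffChange_root`, abc-iut-w4-d014's `coeffChange_h1TopAut`, abc-iut-w4-d010's bookkeeping (`inversionAlpha_apply_apply_eq_conj`,
`thetaCompanion_mem_deltaTheta`, `coeffChange_rootLiftClass_eq_comap`) — i.e. EXACTLY the proof skeleton of
`prop22_ii'_model_of_inversion_of_classLevel` (`ThetaEvaluationSettingModelAssembly2`), whose conclusion `Prop22_ii' Dec` hides the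
action; and file 4 of this row.

* `EtaleThetaDataOfSetting.rootLevel_inputs_of_classLevel` — the root-class-level (R2)(R3) triple (`hsign`, `hroot` for
  `inversionTransport`, `hfree`) FROM: the inversion datum (`ι`, `ι(Π^tp_{X̲̲}) = Π^tp_{X̲̲}`, theta companion `c`, `ι² = conj δ` on
  `Π^tp_{X̲̲}`, `ι ≡ +1` on `Δ_Θ/l·Δ_Θ`), a deck element `ε`, a `toLZ`-generator `γ`, and the three `Δ_Θ`-CLASS-level statements on
  `η̈^Θ = E.etaDd`: the `ε`-sign (`h14sign`), the `ι`-translate (`h14iota`), the non-torsion of the `γ`-translates (`h14free`).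
* `EtaleLevels.horbit_thetaEnvData_inversion_of_classLevel` / `horb_toRecord_inversion_of_classLevel` /
  `hroots_toRecord_inversion_of_classLevel` — file 4's three theorems with (R2)(R3) replaced by the class-level statements.
RESIDUAL of the `horb`/`hroots` inputs of [IUTchII] Cor 3.5 (ii) at the genuine data after this file = {the [EtTh] inversion datum
(+ `ℤ`-reversal at `γ`, `ι² = conj δ`, `ι ≡ +1` on `Δ_Θ/l·Δ_Θ`, a deck element), the three `Δ_Θ`-class-level [EtTh] Prop 1.4 statements
on `η̈^Θ` (abc-iut-w4-d010's D-G-w4d010-2f residual; their FUNCTION-level discharge is `prop22_ii'_model_of_thetaKummer`'s route),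
`IsEtThOrigin` + a `CyclotomeTower`, bijective `c`, `μ ⊆ O`}. HONEST FRAMING: composition of landed theorems; nothing disputed is
asserted; no side is taken on [IUTchIII] Cor 3.12; typed ≠ proved ≠ endorsed.
-/

noncomputable section

namespace Literature.IUT.HodgeArakelov

open Literature.AnabelianGeometry.EtaleTheta (ContH1 ThetaSetting RootSystem cyclotome)
open Literature.AnabelianGeometry.EtaleTheta
open EtaleThetaDataOfSetting CohomologySystemOfContH1

/-! ### §1. The root-class-level inputs (R2)(R3) from the `Δ_Θ`-class-level statements -/

namespace EtaleThetaDataOfSetting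

variable {p : ℕ} [Fact p.Prime] {D : Literature.AnabelianGeometry.EtaleTheta.ThetaSetting p}
  {E : D.EtaleThetaData} {l : ℕ} (C : E.DoubleUnderline l)
  (ι : D.PiTemp ≃ₜ* D.PiTemp) (hι : C.Huu.map ι.toMulEquiv.toMonoidHom = C.Huu) (c : ThetaSetting.ThetaCompanion ι)

/-- **(R2)(R3) at the root-class level FROM the `Δ_Θ`-class level** (the `have`-chain of abc-iut-w4-d010's
`prop22_ii'_model_of_inversion_of_classLevel`, packaged as a theorem): from the inversion datum, a deck element `ε`, a
`toLZ`-generator `γ`, `ι² = conj δ` on `Π^tp_{X̲̲}`, `ι ≡ +1` on `Δ_Θ/l·Δ_Θ`, and the `Δ_Θ`-class-level [EtTh] Prop 1.4 statements on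
`η̈^Θ` — the `ε`-sign, the `ι`-translate, the non-torsion of the `γ`-translates — one gets, for the chosen root class `η̲̈^Θ`: (R2)
`hsign` (`ε·η̲̈ = η̲̈·κ`, `κ² = 1`) and `hroot` (`inversionTransport` carries `η̲̈` to a `Π^tp_{Y̲̲}`-conjugate), (R3) `hfree`.
[cite: MochizukiEtTh2009, Prop 1.4 (ii) p.22] -/
theorem rootLevel_inputs_of_classLevel [hN : (PiYdd C).Normal] [hYN : D.GtpYdd.Normal] (hS : D.Sec2Hyps)
    (hchar : PiYddCharacteristic C)
    (γ ε : Pi C) (hγ : C.toLZ γ = Multiplicative.ofAdd 1) (hε₁ : (ε : D.PiTemp) ∈ D.GtpY)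
    (hε₂ : (ε : D.PiTemp) ∉ D.GtpYdd)
    (δ : Pi C) (hιι : ∀ x : Pi C, ι (ι (x : D.PiTemp)) = (δ : D.PiTemp) * (x : D.PiTemp) * (δ : D.PiTemp)⁻¹)
    (hβ : ∀ a : D.GtpTheta, a ∈ D.DeltaTheta → c.thetaIso a * a⁻¹ ∈ D.lDeltaTheta l)
    (h14sign : ∃ κ₁ : ContH1 D.toTheta D.DeltaTheta D.GtpYdd, κ₁ ^ 2 = 1 ∧
      ContH1.conj D.toTheta D.DeltaTheta (ε : D.PiTemp) E.etaDd = E.etaDd * κ₁)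
    (h14iota : ContH1Aut.autMap (phi C) D.DeltaTheta (inversionAlpha C ι hι) c.thetaIso
        (thetaCompanion_phi C ι hι c) (thetaCompanion_mem_deltaTheta ι c)
        (symm_mem_inf_top (PiYdd C) (inversionAlpha C ι hι) (mem_PiYdd_iff_of_piYddCharacteristic C hchar _))
        (ContH1.comap D.toTheta D.DeltaTheta C.Huu.subtype continuous_subtype_val
          (map_subtype_piYdd_inf_le_GtpYdd C ⊤) E.etaDd) =
      ContH1.conj (phi C) D.DeltaTheta ε
        (ContH1.comap D.toTheta D.DeltaTheta C.Huu.subtype continuous_subtype_val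
          (map_subtype_piYdd_inf_le_GtpYdd C ⊤) E.etaDd))
    (h14free : ∀ k : ℤ, k ≠ 0 → ¬ IsOfFinOrder
      (ContH1.comap D.toTheta D.DeltaTheta C.Huu.subtype continuous_subtype_val
        (map_subtype_piYdd_inf_le_GtpYdd C ⊤)
        (ContH1.conj D.toTheta D.DeltaTheta ((γ : D.PiTemp) ^ k) E.etaDd * E.etaDd⁻¹))) :
    (∃ κ : ContH1 (phi C) (D.lDeltaTheta l) (PiYdd C ⊓ ⊤), κ ^ 2 = 1 ∧
        ContH1.conj (phi C) (D.lDeltaTheta l) ε (rootLiftClass C) = rootLiftClass C * κ) ∧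
      (∃ τ₀ : Pi C, (τ₀ : D.PiTemp) ∈ D.GtpY ∧
        inversionTransport C ι hι c hchar (rootLiftClass C) = ContH1.conj (phi C) (D.lDeltaTheta l) τ₀ (rootLiftClass C)) ∧
      (∀ m n : ℤ, IsOfFinAddOrder
        ((h1Top C).symm (Additive.ofMul (ContH1.conj (phi C) (D.lDeltaTheta l) (γ ^ m) (rootLiftClass C))) -
          (h1Top C).symm (Additive.ofMul (ContH1.conj (phi C) (D.lDeltaTheta l) (γ ^ n) (rootLiftClass C)))) →
        m = n) := by
  -- the pair and its bookkeeping, under the NAMES of abc-iut-w5-d072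
  have hφ := thetaCompanion_phi C ι hι c
  have hA : ∀ a : D.GtpTheta, a ∈ D.lDeltaTheta l → c.thetaIso a ∈ D.lDeltaTheta l :=
    fun a ha => (mem_lDeltaTheta_iff_thetaCompanion ι c l a).mp ha
  have hH := mem_PiYdd_iff_of_piYddCharacteristic C hchar (inversionAlpha C ι hι)
  -- (R2) hsign and (R3) hfree / hfreeK at the root-class level (abc-iut-L2-t8's transports)
  have hsign := hsign_of_etaDd_sign C hS ε hε₁ h14sign
  have hfreeK := not_isOfFinOrder_translate_of_etaDd C γ h14free
  have hfree := hfree_of_etaDd_free C γ h14free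
  -- (R2) hroot: the Δ_Θ-image of `T η̲̈` is the `ε`-conjugate of the Δ_Θ-image of `η̲̈`
  have hΔ : ∃ τ₀ : Pi C, (τ₀ : D.PiTemp) ∈ D.GtpY ∧
      ContH1.coeffChange (phi C) (D.lDeltaTheta_le l) (PiYdd C ⊓ ⊤)
          (h1TopAut (phi C) (D.lDeltaTheta l) (PiYdd C) (inversionAlpha C ι hι) c.thetaIso hφ hA hH
            (rootLiftClass C)) =
        ContH1.conj (phi C) D.DeltaTheta τ₀
          (ContH1.coeffChange (phi C) (D.lDeltaTheta_le l) (PiYdd C ⊓ ⊤) (rootLiftClass C)) := by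
    refine ⟨ε, hε₁, ?_⟩
    rw [coeffChange_h1TopAut (phi C) (D.lDeltaTheta_le l) (PiYdd C) (inversionAlpha C ι hι) c.thetaIso hφ hA hH
        (thetaCompanion_mem_deltaTheta ι c), coeffChange_rootLiftClass_eq_comap, h1TopAut_apply]
    exact h14iota
  have hroot := hroot_of_coeffChange_root C (inversionAlpha C ι hι) c.thetaIso hφ hA hH hS γ ε hγ hε₁ hε₂ hsign
    hfreeK δ (inversionAlpha_apply_apply_eq_conj C ι hι δ hιι) hβ hΔ
  exact ⟨hsign, hroot, hfree⟩

end EtaleThetaDataOfSetting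

/-! ### §2. `horbit` / `horb` / `hroots` at the genuine data from the class-level statements -/

namespace EtaleLevels

open TemperedThetaMonoids BadPrimeGaussianMonoids

variable {p : ℕ} [Fact p.Prime] {D : Literature.AnabelianGeometry.EtaleTheta.ThetaSetting p}
  {E : D.EtaleThetaData} {l : ℕ} (C : E.DoubleUnderline l) (hC : D.Compat) (hS : D.Sec2Hyps)
  (hl : l.Prime) (hp2 : p ≠ 2) (hpl : p ≠ l) (hζ : ∃ ζ : D.K, IsPrimitiveRoot ζ (4 * l))
  (mods : ∀ M : ℕ+, D.CyclotomeMod l M)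
  (f : contCocycles D.toTheta D.DeltaTheta C.GtpYdduu) (hf : f ∈ C.rootCocycles hC)
  (hmods : ∀ (M M' : ℕ+) (h : (M : ℕ) ∣ (M' : ℕ)) (x : D.lDeltaTheta l),
    MuN.red p M M' h ((mods M').red x) = (mods M).red x)
  (h15 : Literature.AnabelianGeometry.EtaleTheta.ThetaSetting.Prop15iii E hC) (L : C.CuspLabels)
  (hZ : ∀ M : ℕ+, Nonempty (ModelCyclotomes.lDeltaQuot (C.rigidData (mods M) hC hS h15 L) ≃*
    Literature.IUT.HodgeTheaters.ZHat))
  (hcharY : EtaleThetaDataOfSetting.PiYddCharacteristic C)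
  (hlim : Function.Bijective (rigidLimHom C hC hS hl hp2 hpl hζ mods f hf hmods h15 L hZ))
  [(EtaleThetaDataOfSetting.PiYdd C).Normal] [hYN : D.GtpYdd.Normal]
  (hO : D.IsEtThOrigin) {Es : Set ℕ+} (τc : D.CyclotomeTower l Es)
  -- the [EtTh] inversion datum
  (ι : D.PiTemp ≃ₜ* D.PiTemp) (hι : C.Huu.map ι.toMulEquiv.toMonoidHom = C.Huu) (cι : ThetaSetting.ThetaCompanion ι)
  (γ ε : Pi C) (hγ : C.toLZ γ = Multiplicative.ofAdd 1) (hε₁ : (ε : D.PiTemp) ∈ D.GtpY)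
  (hε₂ : (ε : D.PiTemp) ∉ D.GtpYdd) (hZι : D.toZ (ι (γ : D.PiTemp)) = (D.toZ (γ : D.PiTemp))⁻¹)
  (δ : Pi C) (hιι : ∀ x : Pi C, ι (ι (x : D.PiTemp)) = (δ : D.PiTemp) * (x : D.PiTemp) * (δ : D.PiTemp)⁻¹)
  (hβ : ∀ a : D.GtpTheta, a ∈ D.DeltaTheta → cι.thetaIso a * a⁻¹ ∈ D.lDeltaTheta l)
  -- the Δ_Θ-class-level [EtTh] Prop 1.4 statements on `η̈^Θ`
  (h14sign : ∃ κ₁ : ContH1 D.toTheta D.DeltaTheta D.GtpYdd, κ₁ ^ 2 = 1 ∧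
    ContH1.conj D.toTheta D.DeltaTheta (ε : D.PiTemp) E.etaDd = E.etaDd * κ₁)
  (h14iota : ContH1Aut.autMap (phi C) D.DeltaTheta (inversionAlpha C ι hι) cι.thetaIso
      (thetaCompanion_phi C ι hι cι) (thetaCompanion_mem_deltaTheta ι cι)
      (symm_mem_inf_top (PiYdd C) (inversionAlpha C ι hι) (mem_PiYdd_iff_of_piYddCharacteristic C hcharY _))
      (ContH1.comap D.toTheta D.DeltaTheta C.Huu.subtype continuous_subtype_val
        (map_subtype_piYdd_inf_le_GtpYdd C ⊤) E.etaDd) =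
    ContH1.conj (phi C) D.DeltaTheta ε
      (ContH1.comap D.toTheta D.DeltaTheta C.Huu.subtype continuous_subtype_val
        (map_subtype_piYdd_inf_le_GtpYdd C ⊤) E.etaDd))
  (h14free : ∀ k : ℤ, k ≠ 0 → ¬ IsOfFinOrder
    (ContH1.comap D.toTheta D.DeltaTheta C.Huu.subtype continuous_subtype_val
      (map_subtype_piYdd_inf_le_GtpYdd C ⊤)
      (ContH1.conj D.toTheta D.DeltaTheta ((γ : D.PiTemp) ^ k) E.etaDd * E.etaDd⁻¹)))

include hO τc hγ hε₁ hε₂ hZι hιι hβ h14sign h14iota h14free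

/-- **`horbit` AT THE GENUINE `θ_env` DATA from the inversion datum and the `Δ_Θ`-class-level [EtTh] Prop 1.4 statements**
([IUTchII] Prop 2.2 (ii) p. 66 / Prop 3.1 (i) p. 87): file 4's `horbit_thetaEnvData_inversion` with (R2)(R3) supplied by
`rootLevel_inputs_of_classLevel`. [cite: Mochizuki2012, Prop 2.2 (ii) p.66] -/
theorem horbit_thetaEnvData_inversion_of_classLevel :
    ∀ x ∈ (thetaEnvData C hC hS hl hp2 hpl hζ mods f hf hmods h15 L hZ hcharY hlim).thetaIotaLim
        (pairRhoLim C (inversionAlpha C ι hι) cι.thetaIso (thetaCompanion_phi C ι hι cι)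
          (mem_lDeltaTheta_iff_thetaCompanion ι cι l) (mem_PiYdd_iff_of_piYddCharacteristic C hcharY _)),
      ∀ x' ∈ (thetaEnvData C hC hS hl hp2 hpl hζ mods f hf hmods h15 L hZ hcharY hlim).thetaIotaLim
        (pairRhoLim C (inversionAlpha C ι hι) cι.thetaIso (thetaCompanion_phi C ι hι cι)
          (mem_lDeltaTheta_iff_thetaCompanion ι cι l) (mem_PiYdd_iff_of_piYddCharacteristic C hcharY _)),
        IsOfFinAddOrder (x' - x) := by
  obtain ⟨hsign, hroot, hfree⟩ := rootLevel_inputs_of_classLevel C ι hι cι hS hcharY γ ε hγ hε₁ hε₂ δ hιι hβ h14sign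
    h14iota h14free
  exact horbit_thetaEnvData_inversion C hC hS hl hp2 hpl hζ mods f hf hmods h15 L hZ hcharY hlim hO τc ι hι cι γ ε hγ hε₁ hε₂
    hZι hsign hroot hfree

section AnyConstants

variable {Iota : Type}
  (iota : Iota → ((thetaEnvData C hC hS hl hp2 hpl hζ mods f hf hmods h15 L hZ hcharY hlim).D.coh.lim ≃+
    (thetaEnvData C hC hS hl hp2 hpl hζ mods f hf hmods h15 L hZ hcharY hlim).D.coh.lim))
  {A : Type} [CommGroup A] [MulDistribMulAction (Pi C) A] [TopologicalSpace A] [RootableBy A ℕ]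
  (c : CyclotomeCoefficients (phi C) (D.lDeltaTheta l) A)
  (hA : ∀ b : A, IsOpen (MulAction.stabilizer (Pi C) b : Set (Pi C)))
  (hfi : ∀ b : A, (MulAction.stabilizer (Pi C) b).FiniteIndex)
  (O : Submonoid A)

/-- **The Cor 3.5 (ii) junction input `horb` AT THE GENUINE RECORD from the inversion datum and the `Δ_Θ`-class-level
[EtTh] Prop 1.4 statements** ([IUTchII] Cor 2.8 (i) p. 82 / Prop 3.1 (i) p. 87): `θ^{i₀}_env(𝕄_*)` is ONE `M^×_TM`-orbit for ANY
inversion family with `iota i₀ =` the limit action of `ι`. [cite: Mochizuki2012, Cor 2.8 (i) p.82] -/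
theorem horb_toRecord_inversion_of_classLevel (hc : Function.Bijective c.hom)
    (hOtors : ∀ a : A, IsOfFinOrder a → a ∈ O ∧ a⁻¹ ∈ O) {i₀ : Iota}
    (hi₀ : iota i₀ = pairRhoLim C (inversionAlpha C ι hι) cι.thetaIso (thetaCompanion_phi C ι hι cι)
      (mem_lDeltaTheta_iff_thetaCompanion ι cι l) (mem_PiYdd_iff_of_piYddCharacteristic C hcharY _))
    {θ : ((thetaEnvData C hC hS hl hp2 hpl hζ mods f hf hmods h15 L hZ hcharY hlim).toRecord
          (h1LimConjMulAut (phi C) (D.lDeltaTheta l) (PiYdd C))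
          (h1LimKummerOn (phi C) (D.lDeltaTheta l) (PiYdd C) c hA hfi O) iota).H}
    (hθ : θ ∈ ((thetaEnvData C hC hS hl hp2 hpl hζ mods f hf hmods h15 L hZ hcharY hlim).toRecord
          (h1LimConjMulAut (phi C) (D.lDeltaTheta l) (PiYdd C))
          (h1LimKummerOn (phi C) (D.lDeltaTheta l) (PiYdd C) c hA hfi O) iota).thetaEnv i₀) :
    ∀ θ' ∈ ((thetaEnvData C hC hS hl hp2 hpl hζ mods f hf hmods h15 L hZ hcharY hlim).toRecord
          (h1LimConjMulAut (phi C) (D.lDeltaTheta l) (PiYdd C))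
          (h1LimKummerOn (phi C) (D.lDeltaTheta l) (PiYdd C) c hA hfi O) iota).thetaEnv i₀,
      ∃ u ∈ ((thetaEnvData C hC hS hl hp2 hpl hζ mods f hf hmods h15 L hZ hcharY hlim).toRecord
          (h1LimConjMulAut (phi C) (D.lDeltaTheta l) (PiYdd C))
          (h1LimKummerOn (phi C) (D.lDeltaTheta l) (PiYdd C) c hA hfi O) iota).units, θ' = u * θ := by
  obtain ⟨hsign, hroot, hfree⟩ := rootLevel_inputs_of_classLevel C ι hι cι hS hcharY γ ε hγ hε₁ hε₂ δ hιι hβ h14sign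
    h14iota h14free
  exact horb_toRecord_inversion C hC hS hl hp2 hpl hζ mods f hf hmods h15 L hZ hcharY hlim hO τc ι hι cι γ ε hγ hε₁ hε₂ hZι
    iota c hA hfi O hc hOtors hsign hroot hfree hi₀ hθ

/-- **Print's root condition `hroots` AT THE GENUINE RECORD from the inversion datum and the `Δ_Θ`-class-level [EtTh] Prop 1.4
statements** ([IUTchII] Prop 1.4 p. 27 / Cor 3.5 (ii) p. 95, `∞`-level): every `ϑ ∈ ∞θ^{i₀}_env(𝕄_*)` has a positive power in
`M^×_TM · θ^ℕ`, for ANY inversion family with `iota i₀ =` the limit action of `ι`. [cite: Mochizuki2012, Cor 3.5 (ii) p.95] -/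
theorem hroots_toRecord_inversion_of_classLevel (hc : Function.Bijective c.hom)
    (hOtors : ∀ a : A, IsOfFinOrder a → a ∈ O ∧ a⁻¹ ∈ O) {i₀ : Iota}
    (hi₀ : iota i₀ = pairRhoLim C (inversionAlpha C ι hι) cι.thetaIso (thetaCompanion_phi C ι hι cι)
      (mem_lDeltaTheta_iff_thetaCompanion ι cι l) (mem_PiYdd_iff_of_piYddCharacteristic C hcharY _))
    {θ : ((thetaEnvData C hC hS hl hp2 hpl hζ mods f hf hmods h15 L hZ hcharY hlim).toRecord
          (h1LimConjMulAut (phi C) (D.lDeltaTheta l) (PiYdd C))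
          (h1LimKummerOn (phi C) (D.lDeltaTheta l) (PiYdd C) c hA hfi O) iota).H}
    (hθ : θ ∈ ((thetaEnvData C hC hS hl hp2 hpl hζ mods f hf hmods h15 L hZ hcharY hlim).toRecord
          (h1LimConjMulAut (phi C) (D.lDeltaTheta l) (PiYdd C))
          (h1LimKummerOn (phi C) (D.lDeltaTheta l) (PiYdd C) c hA hfi O) iota).thetaEnv i₀) :
    ∀ ϑ ∈ ((thetaEnvData C hC hS hl hp2 hpl hζ mods f hf hmods h15 L hZ hcharY hlim).toRecord
          (h1LimConjMulAut (phi C) (D.lDeltaTheta l) (PiYdd C))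
          (h1LimKummerOn (phi C) (D.lDeltaTheta l) (PiYdd C) c hA hfi O) iota).inftyThetaEnv i₀,
      ∃ N : ℕ, 0 < N ∧ ϑ ^ N ∈ splitMonoid ((thetaEnvData C hC hS hl hp2 hpl hζ mods f hf hmods h15 L hZ hcharY hlim).toRecord
          (h1LimConjMulAut (phi C) (D.lDeltaTheta l) (PiYdd C))
          (h1LimKummerOn (phi C) (D.lDeltaTheta l) (PiYdd C) c hA hfi O) iota).units (Submonoid.powers θ) := by
  obtain ⟨hsign, hroot, hfree⟩ := rootLevel_inputs_of_classLevel C ι hι cι hS hcharY γ ε hγ hε₁ hε₂ δ hιι hβ h14sign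
    h14iota h14free
  exact hroots_toRecord_inversion C hC hS hl hp2 hpl hζ mods f hf hmods h15 L hZ hcharY hlim hO τc ι hι cι γ ε hγ hε₁ hε₂ hZι
    iota c hA hfi O hc hOtors hsign hroot hfree hi₀ hθ

end AnyConstants

end EtaleLevels

end Literature.IUT.HodgeArakelov

end
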